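import Summits.ABC.ABC.Theses.RibetTakahashiSplit
import Literature.NumberTheory.EllipticCurves.Szpiro

/-!
# Sketch — crux idea `thin-strong-hall-transfer` (crux stmt-ABC-17927 `ThinWeightedSzpiro`, ideator 2, round 1)

First-lemma signatures over existing declarations (they ELABORATE; the research statements are `def … : Prop`,
the elementary ones are proved):

* `ThinStrongHall` — the ℤ/ℕ normal form of the crux ("thin STRONG HALL"): for integers `x, y` with
  `z := x³ − y² ≠ 0`, `1728 ∣ z`, primitive at `2, 3` (`Prim23`, = minimality at `2, 3` via Kraus 1989) and no prime
  `p ≥ 5` dividing both `x` and `z` (= minimality + semistability at `p ≥ 5` of the curve with invariants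
  `(c₄, c₆, 1728Δ) = (x, y, z)`), with `N' := rad_{≥5}(z)`, `T' := ∏_{p≥5, p∣z} v_p(z)`:
  `T' ≤ K·N'^θ ⟹ max(|z|, |x|³) ≤ C·(N'·T')^{6+ε}` (quantifiers `∃θ>0 ∀ε>0 ∀K ∃C` exactly as in the crux).
* `Transfer` — the stub the line proves first: `ThinStrongHall → ThinWeightedSzpiro` (set `x = c₄ W₀`, `y = c₆ W₀`,
  `z = 1728·Δ W₀` by `WeierstrassCurve.c_relation`; primes `p ≥ 5` of `Δ` are multiplicative for a minimal model
  semistable away from 2, so `p ∤ c₄`; `N' ≤ N`, `T' ≤ T`, and `K·N^θ ≤ K·(2⁸3⁵)^θ·N'^θ`).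
* `ThinStrongHallCusp` / `ThinStrongHallBulk` and `thinStrongHall_of_cusp_of_bulk` (PROVED): the regime split
  `|z| ≤ |x|³` (cusp: `|j| ≥ 1728`, the Hall corner) vs `|x|³ < |z|` (bulk).
* `freyCurve_cusp` (PROVED): `1728·Δ ≤ c₄³` for EVERY Frey–Hellegouarch curve — Frey curves never enter the bulk,
  so the route's `closes` only ever instantiates the cusp half.
-/

set_option linter.dupNamespace false

namespace Summit.ABC.ABC.Cruxes.ThinWeightedSzpiro.ThinStrongHallTransfer

open Summit.ABC.ABC.Theses.RibetTakahashiSplit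
open Literature.NumberTheory.EllipticCurves

/-- Radical of the prime-to-6 part of `z`: `∏_{p ≥ 5, p ∣ z} p` (empty product `= 1`). -/
def rad5 (z : ℤ) : ℕ := ∏ p ∈ z.natAbs.primeFactors with 5 ≤ p, p

/-- Exponent weight of the prime-to-6 part of `z`: `∏_{p ≥ 5, p ∣ z} v_p(z)` (empty product `= 1`). -/
def wt5 (z : ℤ) : ℕ := ∏ p ∈ z.natAbs.primeFactors with 5 ≤ p, z.natAbs.factorization p

/-- PRIMITIVITY at `2` and `3` (the scaling `(x, y, z) ↦ (d⁴x, d⁶y, d¹²z)` fixes `rad5, wt5`, so some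
normalisation at `2, 3` is needed for truth). These two conditions are exactly what MINIMALITY of a model with
invariants `(c₄, c₆, Δ) = (x, y, z/1728)` gives through Kraus's realizability criterion (Kraus 1989, Prop. 2:
`(c₄', c₆')` come from a `ℤ`-model iff `v₃(c₆') ≠ 2` and [`c₆' ≡ −1 (4)` or (`16 ∣ c₄'` and `c₆' ≡ 0, 8 (32)`)]):
if `2⁸ ∣ c₄ ∧ 2¹¹ ∣ c₆ ∧ 2¹² ∣ Δ` (resp. `3⁴ ∣ c₄ ∧ 3⁹ ∣ c₆ ∧ 3¹² ∣ Δ`) the once-scaled invariants are realizable,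
contradicting minimality at `2` (resp. `3`). Conversely they bound the minimal scaling of the curve
`Y² = X³ − 27x·X − 54y` by `u ∣ 36`, which is why the normal form follows from ABC. -/
def Prim23 (x y : ℤ) : Prop :=
  ¬ ((2 : ℤ) ^ 8 ∣ x ∧ (2 : ℤ) ^ 11 ∣ y ∧ (2 : ℤ) ^ 12 * 1728 ∣ x ^ 3 - y ^ 2) ∧
  ¬ ((3 : ℤ) ^ 4 ∣ x ∧ (3 : ℤ) ^ 9 ∣ y ∧ (3 : ℤ) ^ 12 * 1728 ∣ x ^ 3 - y ^ 2)

/-- The weighted thin strong-Hall inequality at level `(θ, ε, K, C)` for one pair `(x, y)`, with an extra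
regime hypothesis `R`. Inputs: `z := x³ − y² ≠ 0` with `1728 ∣ z` (so `Δ := z/1728 ∈ ℤ`), primitive at `2, 3`
(`Prim23`), and no prime `p ≥ 5` dividing both `x` and `z` (minimality + semistability at `p ≥ 5`). -/
def HallIneq (R : ℤ → ℤ → Prop) (θ ε K C : ℝ) : Prop :=
  ∀ x y : ℤ, x ^ 3 - y ^ 2 ≠ 0 → (1728 : ℤ) ∣ x ^ 3 - y ^ 2 → Prim23 x y → R x y →
    (∀ p : ℕ, p.Prime → 5 ≤ p → (p : ℤ) ∣ x → ¬ (p : ℤ) ∣ x ^ 3 - y ^ 2) →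
    (wt5 (x ^ 3 - y ^ 2) : ℝ) ≤ K * (rad5 (x ^ 3 - y ^ 2) : ℝ) ^ θ →
    ((max |x ^ 3 - y ^ 2| (|x| ^ 3) : ℤ) : ℝ) ≤
      C * ((rad5 (x ^ 3 - y ^ 2) : ℝ) * (wt5 (x ^ 3 - y ^ 2) : ℝ)) ^ (6 + ε)

/-- `∃θ>0 ∀ε>0 ∀K ∃C` wrapper (the crux's quantifier shape, class exponent frozen outside `∀ε ∀K`). -/
def ThinLaw (R : ℤ → ℤ → Prop) : Prop :=
  ∃ θ : ℝ, 0 < θ ∧ ∀ ε : ℝ, 0 < ε → ∀ K : ℝ, ∃ C : ℝ, HallIneq R θ ε K C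

/-- **ThinStrongHall** — the ℕ normal form of `ThinWeightedSzpiro` (strong Hall, Bombieri–Gubler Conj. 12.5.3,
restricted to the thin class and weighted by the exponent product; `2, 3` dropped from radical and weight). -/
def ThinStrongHall : Prop := ThinLaw fun _ _ => True

/-- Cusp half: `|z| ≤ |x|³`, i.e. `|j| ≥ 1728` — the HALL CORNER (contains every Frey curve, `freyCurve_cusp`). -/
def ThinStrongHallCusp : Prop := ThinLaw fun x y => |x ^ 3 - y ^ 2| ≤ |x| ^ 3

/-- Bulk half: `|x|³ < |z|` — plain weighted Szpiro `|z| ≤ C (N'T')^{6+ε}` for balanced `x³ − y² = z`. -/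
def ThinStrongHallBulk : Prop := ThinLaw fun x y => |x| ^ 3 < |x ^ 3 - y ^ 2|

/-- The TRANSFER stub of the line: the ℕ normal form implies the crux BY NAME. -/
def Transfer : Prop := ThinStrongHall → ThinWeightedSzpiro

theorem one_le_rad5 (z : ℤ) : 1 ≤ rad5 z := by
  unfold rad5
  rw [Nat.one_le_iff_ne_zero, Finset.prod_ne_zero_iff]
  intro p hp
  rw [Finset.mem_filter] at hp
  omega

/-- Monotonicity in the class exponent: a `θ`-thin pair is `θ'`-thin for `θ ≤ θ'` (when `0 ≤ K`). -/
theorem thin_mono {θ θ' K : ℝ} (hθ : θ ≤ θ') (hK : 0 ≤ K) (z : ℤ)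
    (h : (wt5 z : ℝ) ≤ K * (rad5 z : ℝ) ^ θ) : (wt5 z : ℝ) ≤ K * (rad5 z : ℝ) ^ θ' := by
  refine h.trans (mul_le_mul_of_nonneg_left ?_ hK)
  exact Real.rpow_le_rpow_of_exponent_le (by exact_mod_cast one_le_rad5 z) hθ

/-- GLUE (proved): the two regimes compose to the normal form, with class exponent `min θ₁ θ₂`. -/
theorem thinStrongHall_of_cusp_of_bulk (hc : ThinStrongHallCusp) (hb : ThinStrongHallBulk) :
    ThinStrongHall := by
  obtain ⟨θ₁, hθ₁, h₁⟩ := hc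
  obtain ⟨θ₂, hθ₂, h₂⟩ := hb
  refine ⟨min θ₁ θ₂, lt_min hθ₁ hθ₂, fun ε hε K => ?_⟩
  obtain ⟨C₁, hC₁⟩ := h₁ ε hε K
  obtain ⟨C₂, hC₂⟩ := h₂ ε hε K
  refine ⟨max C₁ C₂, fun x y hz h1728 hprim _ hcop hthin => ?_⟩
  have hbase : (0 : ℝ) ≤ ((rad5 (x ^ 3 - y ^ 2) : ℝ) * (wt5 (x ^ 3 - y ^ 2) : ℝ)) ^ (6 + ε) := by
    positivity
  by_cases hK : 0 ≤ K
  · rcases le_or_gt |x ^ 3 - y ^ 2| (|x| ^ 3) with hcusp | hbulk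
    · exact (hC₁ x y hz h1728 hprim hcusp hcop (thin_mono (min_le_left _ _) hK _ hthin)).trans
        (mul_le_mul_of_nonneg_right (le_max_left _ _) hbase)
    · exact (hC₂ x y hz h1728 hprim hbulk hcop (thin_mono (min_le_right _ _) hK _ hthin)).trans
        (mul_le_mul_of_nonneg_right (le_max_right _ _) hbase)
  · -- `K < 0`: the thinness hypothesis is unsatisfiable (`wt5 ≥ 0 > K·rad5^θ`), so the goal is vacuous
    exfalso
    set z : ℤ := x ^ 3 - y ^ 2 with hzdef
    have h1 : (1 : ℝ) ≤ (rad5 z : ℝ) := by exact_mod_cast one_le_rad5 z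
    have h0 : (0 : ℝ) < (rad5 z : ℝ) ^ (min θ₁ θ₂) := Real.rpow_pos_of_pos (by linarith) _
    have hneg : K * (rad5 z : ℝ) ^ (min θ₁ θ₂) < 0 := mul_neg_of_neg_of_pos (lt_of_not_ge hK) h0
    have hw : (0 : ℝ) ≤ (wt5 z : ℝ) := by positivity
    linarith

/-- **Frey cusp lemma** (proved): `1728·Δ ≤ c₄³` for every Frey–Hellegouarch curve `y² = x(x − a)(x + b)`,
i.e. `j ≥ 1728` — the identity `4(a²+ab+b²)³ − 27(ab(a+b))² = ((a−b)(2a+b)(a+2b))²` (discriminant of the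
2-division cubic with integer roots `0, a, −b`). So Frey curves live in the cusp regime only. [folklore] -/
theorem freyCurve_cusp (a b : ℤ) : 1728 * (freyCurve a b).Δ ≤ (freyCurve a b).c₄ ^ 3 := by
  have hc : (freyCurve a b).c₄ = 16 * ((a : ℚ) ^ 2 + a * b + b ^ 2) := by
    simp only [WeierstrassCurve.c₄, WeierstrassCurve.b₂, WeierstrassCurve.b₄, freyCurve_a₁,
      freyCurve_a₂, freyCurve_a₃, freyCurve_a₄]
    ring
  rw [freyCurve_Δ, hc]
  nlinarith [sq_nonneg (((a : ℚ) - b) * (2 * a + b) * (a + 2 * b))]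

/-- The crux decl this idea serves (by name). -/
example : Prop := ThinWeightedSzpiro

end Summit.ABC.ABC.Cruxes.ThinWeightedSzpiro.ThinStrongHallTransfer
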